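import Literature.IUT.HodgeArakelov.AbsTopMonoidsGenuineProducer
import Literature.IUT.HodgeArakelov.ThetaSettingDeltaCharacteristic
import Literature.AnabelianGeometry.AbsoluteAnabelian.MLFGaloisPairsWitness
import Literature.AnabelianGeometry.AbsoluteAnabelian.FundamentalExtensionProSigmaGeomModel
import Literature.AnabelianGeometry.AbsoluteAnabelian.AbsTopIProp23PuncturedSurfaceModelProofs
import Mathlib.RingTheory.RootsOfUnity.Complex
import HarnessLib

/-!
# [IUTchII] Ex 1.8: the GENUINE producer `AbsTopMonoids.genuineOfModel` APPLIES at a setting with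
# `G_k = Gal(ℚ̄_p/ℚ_p)` ON THE NOSE (`ε = id`) and nontrivial free pro-`Σ` `Δ` — non-vacuity certificate

S. Mochizuki, *Inter-universal Teichmüller theory II*, §1, Example 1.8 (ii)–(iv) (kurims pp. 36–39)
[claim: Mochizuki2012, status: disputed].  abc-iut-L6-t13's producer
`AbsTopMonoids.genuineOfModel S C ε hΔ hq : AbsTopMonoids S` (p421397; GENUINE monoids
`O^⊳(G) := 𝒪_{k̄}^⊳` with `G` acting through `G ≅ G_k ≅ Gal(k̄/k)`, `O^⊳(f) :=` THE lift of [AbsTopIII]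
Prop 3.2 (iv); `Ism` degenerate = B9 (d)) takes, besides the model identification
`ε : G_k ⥲ Gal(k̄/k)` (`C : MLFClosure`), the two hypotheses (H1) «`Δ ⊆ Π` characteristic» and (H2)
«`Π/Δ ≅ G_k`» — «(H1) stays a hypothesis of every AbsTopMonoids producer» (L6-t13 HANDOFF, L6-lead
§F v1.19j (3)).

THIS PROOF-ONLY FILE (no definitions, no named facts) shows the producer APPLIES — all its hypotheses
DISCHARGED — at the following setting `S` (for every odd prime `l` and odd prime `p ≠ l`):
`Π := Δ × G_{ℚ_p} ↠ G_{ℚ_p}` PROFINITE with `G_k := Gal(ℚ̄_p/ℚ_p)` LITERALLY the Galois group of the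
model closure datum `MLFClosure.ofPadic p` (so `ε := id`), `Δ` a pro-`{2}` completion of
`Γ_{0,3} ≅ F₂` (so `Δ ≠ 1` slim, elastic, topologically finitely generated: [AbsTopI] Prop 2.2 / 2.3 (i)
at the affine model, abc-iut-w5-d206 p424779 / p428005), bare record field `k := ℂ` (`ζ_{4l} = e^{2πi/4l}`,
the `DihedralCuspToy.dSetting` pattern); (H1) by [AbsTopI] Thm 2.6 (iv)
(`ThetaSetting.deltaX_map_eq_of_fundamentalExtension`, elasticity of `G_k` PROVED), (H2) by compactness
(`ThetaSetting.nonempty_quotDeltaX_iso_of_compactSpace`).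

HONEST LABEL: a GROUP-THEORETIC model of the bare-`TopGroup` interface (trivial outer action; `Π` is
neither the tempered nor the profinite `π₁` of print's curve `X̲̲_k`; `k := ℂ` is not tied to `G_k`);
the monoid side of the inhabitant is GENUINE (`𝒪_{ℚ̄_p}^⊳` with its Galois action and the unique
lifts), the isometry side `Ism` is L6-t13's degenerate one (B9 (d) residual).  Nothing here bears on
[IUTchIII] Cor. 3.12; no side is taken.
-/

noncomputable section

namespace Literature.IUT.HodgeArakelov

open Literature.AnabelianGeometry.AbsoluteAnabelian
open Literature.AnabelianGeometry.SemiGraphs.SemiGraphOfAnabelioids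
open Literature.AlgebraicGeometry.Frobenioids (IsSlimGroup)
open Literature.GroupTheory.CombinatorialGroupTheory Field

/-- **The genuine producer applies at a profinite setting with `G_k = Gal(ℚ̄_p/ℚ_p)` (`ε = id`) and
nontrivial free pro-`{2}` `Δ`.**  For an odd prime `l` and an odd prime `p ≠ l` there are a setting
`S : ThetaSetting` (`S.l = l`, `S.p = p`), a model identification `ε` of `S.Gk` with the Galois group of
`MLFClosure.ofPadic p` (here the IDENTITY), and proofs `hΔ` of (H1), `hq` of (H2), such that `Π^{(S)}` is
compact, `Δ^{(S)} ≠ 1` is slim, elastic and topologically finitely generated, `G_k^{(S)}` is infinite, and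
`AbsTopMonoids.genuineOfModel S (MLFClosure.ofPadic p) ε hΔ hq : AbsTopMonoids S` is a term (recorded as
`Nonempty`).  Group-theoretic model — see the module docstring.
[cite: MochizukiAbsTopI2012, Thm 2.6 (iv) p.22] -/
theorem exists_thetaSetting_genuineOfModel (l p : ℕ) [Fact p.Prime] (hl : l.Prime) (hl2 : l ≠ 2)
    (hp2 : p ≠ 2) (hpl : p ≠ l) :
    ∃ (S : ThetaSetting.{0})
      (ε : S.Gk ≃ₜ* (ModelMLFGaloisData.galois (MLFClosure.ofPadic p).k
        (MLFClosure.ofPadic p).K).tmPair.Pi)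
      (hΔ : ∀ f : S.PiX ≃ₜ* S.PiX, S.DeltaX.map f.toMulEquiv.toMonoidHom = S.DeltaX)
      (hq : Nonempty (TopGroup.quot S.PiX S.DeltaX ≃ₜ* S.Gk)),
      S.l = l ∧ S.p = p ∧ CompactSpace S.PiX ∧ Infinite S.Gk ∧ S.DeltaX ≠ ⊥ ∧
        IsSlimGroup S.DeltaX ∧ IsElastic S.DeltaX ∧ IsTopologicallyFinitelyGenerated S.DeltaX ∧
        Nonempty (AbsTopMonoids S) ∧
        Nonempty { A : AbsTopMonoids S // A = AbsTopMonoids.genuineOfModel S _ ε hΔ hq } := by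
  classical
  have hp : p.Prime := Fact.out
  -- `Δ`: a pro-`{2}` completion of `Γ_{0,3}`
  obtain ⟨P, ι₀, hι₀⟩ :=
    IsProSigmaCompletion.exists_isProSigmaCompletion (PuncturedSurfaceGroup 0 3) ({2} : Set ℕ)
  -- the product extension `Δ × G_{ℚ_p} ↠ G_{ℚ_p}` with MLF base data `K := ℚ_p`, `galIso := id`
  let E : FundamentalExtension.{0} :=
    { arith := ProfiniteGrp.of (P × absoluteGaloisGroup ℚ_[p])
      gal := ProfiniteGrp.of (absoluteGaloisGroup ℚ_[p])
      aug := ⟨MonoidHom.snd P (absoluteGaloisGroup ℚ_[p]), continuous_snd⟩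
      aug_surjective := fun y => ⟨(1, y), rfl⟩ }
  let B : E.MLFBase := { p := p, K := ℚ_[p], galIso := ContinuousMulEquiv.refl _ }
  have hmem : ∀ x : P, ((x, (1 : absoluteGaloisGroup ℚ_[p])) : E.arith) ∈ E.geom := fun x => by
    rw [FundamentalExtension.mem_geom]; rfl
  have hsnd : ∀ z : E.geom, (z : E.arith).2 = 1 := fun z => (FundamentalExtension.mem_geom E).mp z.2
  let j : P →* E.geom :=
    { toFun := fun x => ⟨(x, 1), hmem x⟩
      map_one' := rfl
      map_mul' := fun a b => Subtype.ext (Prod.ext rfl (mul_one _).symm) }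
  let e : E.geom ≃* P :=
    { toFun := fun z => (z : E.arith).1
      invFun := j
      left_inv := fun z => Subtype.ext (Prod.ext rfl (hsnd z).symm)
      right_inv := fun _ => rfl
      map_mul' := fun _ _ => rfl }
  have he : Continuous e := continuous_fst.comp continuous_subtype_val
  have hes : Continuous e.symm := (continuous_id.prodMk continuous_const).subtype_mk _
  have hι : IsProSigmaCompletion ({2} : Set ℕ) (j.comp ι₀) :=
    IsProSigmaCompletion.of_target_mulEquiv hι₀ e he hes fun _ => rfl
  -- [AbsTopI] Prop 2.2 / 2.3 (i) at the affine model
  have h03 : PuncturedSurfaceGroup.IsHyperbolicType 0 3 := by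
    unfold PuncturedSurfaceGroup.IsHyperbolicType; norm_num
  have hS2 : ∃ ℓ ∈ ({2} : Set ℕ), ℓ.Prime := ⟨2, rfl, Nat.prime_two⟩
  have hSsub : ({2} : Set ℕ) ⊆ {q | q.Prime} := by
    rintro q rfl; exact Nat.prime_two
  have hSne : ({2} : Set ℕ) ≠ {q | q.Prime} := by
    intro h
    have h3 : (3 : ℕ) ∈ ({2} : Set ℕ) := by rw [h]; exact Nat.prime_three
    exact absurd (Set.mem_singleton_iff.mp h3) (by norm_num)
  obtain ⟨htfg, hse, hpro⟩ :=
    FundamentalExtension.geom_props_of_isProSigmaCompletion_puncturedSurfaceGroup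
      (E := E) (by norm_num) h03 hι hS2
  have hne : E.geom ≠ ⊥ :=
    E.geom_ne_bot_of_isProSigmaCompletion_puncturedSurfaceGroup hS2 (by norm_num) h03 _ hι
  -- the setting
  let S : ThetaSetting.{0} :=
    { N := 1
      l := l
      l_prime := hl
      l_odd := hl2
      p := p
      p_prime := hp
      p_odd := hp2
      p_ne_l := hpl
      k := ℂ
      hasPrimitiveRoot := ⟨Complex.exp (2 * Real.pi * Complex.I / (4 * l : ℕ)),
        Complex.isPrimitiveRoot_exp (4 * l) (by have := hl.pos; omega)⟩
      PiX := TopGroup.of E.arith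
      Gk := TopGroup.of E.gal
      aug := E.aug.toMonoidHom
      aug_continuous := E.aug.continuous
      aug_surjective := E.aug_surjective
      modelPi := TopGroup.of (Multiplicative (ZMod 1))
      modelD := ⊤
      modelD_inn := le_top
      modelD_continuous := fun _ _ =>
        ⟨continuous_of_discreteTopology, continuous_of_discreteTopology⟩
      modelTheta := ∅ }
  -- the model identification: `G_k^{(S)} = Gal(ℚ̄_p/ℚ_p)` IS the Galois group of `MLFClosure.ofPadic p`
  let ε : S.Gk ≃ₜ* (ModelMLFGaloisData.galois (MLFClosure.ofPadic p).k
      (MLFClosure.ofPadic p).K).tmPair.Pi := ContinuousMulEquiv.refl _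
  -- (H1) by [AbsTopI] Thm 2.6 (iv), (H2) by compactness
  have hΔ : ∀ f : S.PiX ≃ₜ* S.PiX, S.DeltaX.map f.toMulEquiv.toMonoidHom = S.DeltaX :=
    ThetaSetting.deltaX_map_eq_of_fundamentalExtension S E B htfg hSsub hSne hpro
      (ContinuousMulEquiv.refl _)
      (ThetaSetting.deltaX_map_eq_geom_of_compatible S E (ContinuousMulEquiv.refl _)
        (ContinuousMulEquiv.refl _) (fun _ => rfl))
  haveI : CompactSpace S.PiX := inferInstanceAs (CompactSpace E.arith)
  haveI : T2Space S.Gk := inferInstanceAs (T2Space E.gal)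
  have hq : Nonempty (TopGroup.quot S.PiX S.DeltaX ≃ₜ* S.Gk) :=
    ThetaSetting.nonempty_quotDeltaX_iso_of_compactSpace S
  have hΔE : S.DeltaX = E.geom := rfl
  refine ⟨S, ε, hΔ, hq, rfl, rfl, inferInstance, B.infinite_gal, ?_, hse.1, hse.2, htfg,
    ⟨AbsTopMonoids.genuineOfModel S _ ε hΔ hq⟩, ⟨⟨AbsTopMonoids.genuineOfModel S _ ε hΔ hq, rfl⟩⟩⟩
  rw [hΔE]; exact hne

end Literature.IUT.HodgeArakelov

end
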